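import Summits.HubbardSuperconductivity.HubbardSuperconductivity.Theorems.AnisotropyChordFourTorusTables
import Summits.HubbardSuperconductivity.HubbardSuperconductivity.Theorems.AnisotropyChordFourTorusKernelAgree0
import Summits.HubbardSuperconductivity.HubbardSuperconductivity.Theorems.AnisotropyChordFourTorusKernelAgree1
import Summits.HubbardSuperconductivity.HubbardSuperconductivity.Theorems.AnisotropyChordFourTorusKernelAgree2
import Summits.HubbardSuperconductivity.HubbardSuperconductivity.Theorems.AnisotropyChordFourTorusKernelAgree3
import Summits.HubbardSuperconductivity.HubbardSuperconductivity.Theorems.AnisotropyChordFourTorusCertificate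
import Summits.HubbardSuperconductivity.HubbardSuperconductivity.Theorems.AnisotropyChordTransferBEC
import Summits.HubbardSuperconductivity.HubbardSuperconductivity.Theorems.AnisotropyChordStiffnessOperatorLink
import Summits.HubbardSuperconductivity.HubbardSuperconductivity.Theorems.AnisotropyChordFourTorusFormsB

/-!
# Route `AnisotropyChord`: **the crux `FerroSideChord` HOLDS AT `M = 4`** — a kernel-certified instance for every `Δ ∈ [0, 1]`
(prover seat `hubbard-h0-rotor-p1` g17; `--supports stmt-HubbardSuperconductivity-19089`)

`ferroSideChord_four` is the body of `Theses.AnisotropyChord.FerroSideChord` with `M := 4`: for every `Δ ∈ [0,1]` and every normalised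
`Sᶻ_tot = 0` sector ground state `ψ` of `H₄(Δ) = xxzHamiltonian 1 (torusGraph 2 4) (−1) Δ` on the `4 × 4` torus,
`(1+Δ)/2 · (8 · 9) ≤ Re⟨ψ, S⁺_tot S⁻_tot ψ⟩`.  (The crux item asks this for every even `M ≥ 4`; its `why_might_fail` notes that only
`M = 4` had been checked — numerically.  Here it is a theorem.)

Part A (class variables `v`, 58 of them): reduced forms `normC`, `isingC`, `lowerC`, `hopC`; `quadEntry_eq` expands
`Σ_{r,s} v_r v_s · pEntry D r s` into these forms; `quadEntry_eq_quadLit` identifies it with the certified literal form (`pAgree_*`);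
**`main_form_nonneg`**: for `0 ≤ Δ ≤ 1`, `L(v) − 36(1+Δ)N(v) + 30(A(v) + (1−Δ)W(v) + (8/15)(1−Δ)N(v)) ≥ 0`
(the affine combination `(1−Δ)Q₀ + ΔQ₁` of the two PSD forms of `…FourTorusCertificate`).
Part B: by Perron uniqueness (tree `lambda_eq_lowerNormSq_of_sectorGround`) the claim is `‖S⁻_tot a‖² ≥ 36(1+Δ)` for the sector-`0`
Perron amplitude; in class variables `‖S⁻a‖² = L(v)`, `Σa² = N(v) = 1`, `⟨a,(H+8)a⟩ = A(v) + (1−Δ)W(v) = E₀(Δ)+8 ≤ −(8/15)(1−Δ)`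
(`…FourTorusClasses`, `…FourTorusFormsB`), and `main_form_nonneg` closes.  Numerically the slack `⟨S⁺S⁻⟩ − 36(1+Δ)` is `32.0` at
`Δ = 0` and vanishes linearly at the Heisenberg point (Dicke tangency).
-/

set_option linter.style.longLine false
set_option linter.dupNamespace false
set_option autoImplicit false

open Finset
open Finset Matrix
open Literature.MathematicalPhysics.QuantumLattice Literature.Probability.LatticeModels
open Summit.HubbardSuperconductivity.HubbardSuperconductivity.Theorems.AnisotropyChord.Tower
open Summit.HubbardSuperconductivity.HubbardSuperconductivity.Theorems.AnisotropyChord.InsertionEntropy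
open Summit.HubbardSuperconductivity.HubbardSuperconductivity.Theorems.AnisotropyChord.Transfer
open Summit.HubbardSuperconductivity.HubbardSuperconductivity.Theorems.AnisotropyChord.Stiffness

namespace Summit.HubbardSuperconductivity.HubbardSuperconductivity.Theorems.AnisotropyChord.FourTorus


/-! ## Reduced forms in class variables -/

/-- `N(v) = Σ_r n8 r · v_r²`. [folklore] -/
noncomputable def normC (v : ℕ → ℝ) : ℝ := ∑ r ∈ range 58, (n8 r : ℝ) * v r ^ 2
/-- `W(v) = Σ_r n8 r · (8 − A_r/2) · v_r²`. [folklore] -/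
noncomputable def isingC (v : ℕ → ℝ) : ℝ := ∑ r ∈ range 58, (n8 r : ℝ) * ((8 - (1/2 : ℝ) * (activeEdges r : ℝ)) * v r ^ 2)
/-- `L(v) = Σ_ρ n9 ρ · (Σ_{c ∈ children ρ} v_c)²`. [folklore] -/
noncomputable def lowerC (v : ℕ → ℝ) : ℝ := ∑ ρ ∈ range 56, (n9 ρ : ℝ) * ((children ρ).map v).sum ^ 2
/-- `A(v) = ¼ Σ_ρ n9 ρ · Σ_{(p,q) ∈ ordPairs ρ} (v_p − v_q)²`. [folklore] -/
noncomputable def hopC (v : ℕ → ℝ) : ℝ :=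
  (1/4 : ℝ) * ∑ ρ ∈ range 56, (n9 ρ : ℝ) * ((ordPairs ρ).map fun pq => (v pq.1 - v pq.2) ^ 2).sum
/-- the quadratic form of the assembled matrix `pEntry D`. [folklore] -/
noncomputable def quadEntry (D : ℕ) (v : ℕ → ℝ) : ℝ := ∑ r ∈ range 58, ∑ s ∈ range 58, v r * v s * (pEntry D r s : ℝ)

/-! ## Expanding the assembled matrix -/

/-- the `L` block. [folklore] -/
theorem quad_lEntry (v : ℕ → ℝ) :
    ∑ r ∈ range 58, ∑ s ∈ range 58, v r * v s * (lEntry r s : ℝ) = lowerC v := by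
  unfold lowerC lEntry
  simp_rw [sumN_eq]
  push_cast
  -- both sides as `Σ_ρ n9 ρ · (Σ_r cnt v)(Σ_s cnt v)`
  have hsq : ∀ ρ ∈ range 56, ((children ρ).map v).sum ^ 2
      = ∑ r ∈ range 58, ∑ s ∈ range 58, (cnt ρ r : ℝ) * (cnt ρ s : ℝ) * (v r * v s) := by
    intro ρ hρ
    have hρ' := mem_range.1 hρ
    rw [list_sum_map_eq_count 58 v (children ρ) (children_lt hρ'), sq, Finset.sum_mul_sum]
    refine Finset.sum_congr rfl fun r hr => Finset.sum_congr rfl fun s hs => ?_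
    rw [cnt_eq_count hρ' (mem_range.1 hr), cnt_eq_count hρ' (mem_range.1 hs)]; ring
  have hR : (∑ ρ ∈ range 56, (n9 ρ : ℝ) * ((children ρ).map v).sum ^ 2)
      = ∑ ρ ∈ range 56, (n9 ρ : ℝ) * ∑ r ∈ range 58, ∑ s ∈ range 58, (cnt ρ r : ℝ) * (cnt ρ s : ℝ) * (v r * v s) :=
    Finset.sum_congr rfl (fun ρ hρ => by rw [hsq ρ hρ])
  rw [hR]
  simp_rw [Finset.mul_sum]
  conv_rhs => rw [Finset.sum_comm]
  refine Finset.sum_congr rfl fun r _ => ?_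
  conv_rhs => rw [Finset.sum_comm]
  refine Finset.sum_congr rfl fun s _ => Finset.sum_congr rfl fun ρ _ => by ring

/-- the `H` block: `Σ_{r,s} v_r v_s H[r][s] = Σ_{r,s} hOff r s (v_r − v_s)²`. [folklore] -/
theorem quad_hEntry_eq_hOff (v : ℕ → ℝ) :
    ∑ r ∈ range 58, ∑ s ∈ range 58, v r * v s * (hEntry r s : ℝ)
      = ∑ r ∈ range 58, ∑ s ∈ range 58, (hOff r s : ℝ) * (v r - v s) ^ 2 := by
  unfold hEntry hDiag
  simp_rw [sumN_eq]
  push_cast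
  -- diagonal term
  have hdiag : ∑ r ∈ range 58, ∑ s ∈ range 58, v r * v s * (if r = s then ∑ s' ∈ range 58, ((hOff r s' : ℝ) + (hOff s' r : ℝ)) else 0)
      = ∑ r ∈ range 58, ∑ s ∈ range 58, ((hOff r s : ℝ) * v r ^ 2 + (hOff s r : ℝ) * v r ^ 2) := by
    refine Finset.sum_congr rfl fun r hr => ?_
    simp_rw [mul_ite, mul_zero]
    rw [Finset.sum_ite_eq (range 58) r, if_pos hr, Finset.mul_sum]
    exact Finset.sum_congr rfl fun s _ => by ring
  -- the swapped off-diagonal term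
  have hswap : ∑ r ∈ range 58, ∑ s ∈ range 58, (hOff s r : ℝ) * v r ^ 2 = ∑ r ∈ range 58, ∑ s ∈ range 58, (hOff r s : ℝ) * v s ^ 2 := by
    rw [Finset.sum_comm]
  have hswap2 : ∑ r ∈ range 58, ∑ s ∈ range 58, v r * v s * (hOff s r : ℝ) = ∑ r ∈ range 58, ∑ s ∈ range 58, v r * v s * (hOff r s : ℝ) := by
    rw [Finset.sum_comm]; exact Finset.sum_congr rfl fun r _ => Finset.sum_congr rfl fun s _ => by ring
  have e : ∀ r ∈ range 58, ∀ s ∈ range 58, v r * v s * ((if r = s then ∑ s' ∈ range 58, ((hOff r s' : ℝ) + (hOff s' r : ℝ)) else 0) - (hOff r s : ℝ) - (hOff s r : ℝ))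
      = v r * v s * (if r = s then ∑ s' ∈ range 58, ((hOff r s' : ℝ) + (hOff s' r : ℝ)) else 0) - v r * v s * (hOff r s : ℝ) - v r * v s * (hOff s r : ℝ) := by
    intro r _ s _; ring
  rw [Finset.sum_congr rfl (fun r hr => Finset.sum_congr rfl (fun s hs => e r hr s hs))]
  simp only [Finset.sum_sub_distrib]
  rw [hdiag, hswap2]
  simp only [Finset.sum_add_distrib]
  rw [hswap, ← Finset.sum_add_distrib, ← Finset.sum_sub_distrib, ← Finset.sum_sub_distrib]
  refine Finset.sum_congr rfl fun r _ => ?_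
  rw [← Finset.sum_add_distrib, ← Finset.sum_sub_distrib, ← Finset.sum_sub_distrib]
  exact Finset.sum_congr rfl fun s _ => by ring

/-- the `H` block in reduced form: `Σ_{r,s} hOff r s (v_r − v_s)² = Σ_ρ n9 ρ Σ_{(p,q)} (v_p − v_q)² = 4·hopC v`. [folklore] -/
theorem quad_hOff (v : ℕ → ℝ) :
    ∑ r ∈ range 58, ∑ s ∈ range 58, (hOff r s : ℝ) * (v r - v s) ^ 2 = 4 * hopC v := by
  unfold hopC hOff
  simp_rw [sumN_eq]
  push_cast
  rw [show (4 : ℝ) * ((1/4 : ℝ) * ∑ ρ ∈ range 56, (n9 ρ : ℝ) * ((ordPairs ρ).map fun pq => (v pq.1 - v pq.2) ^ 2).sum)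
      = ∑ ρ ∈ range 56, (n9 ρ : ℝ) * ((ordPairs ρ).map fun pq => (v pq.1 - v pq.2) ^ 2).sum by ring]
  have hl : ∀ ρ ∈ range 56, ((ordPairs ρ).map fun pq => (v pq.1 - v pq.2) ^ 2).sum
      = ∑ p ∈ range 58, ∑ q ∈ range 58, (pqm ρ p q : ℝ) * (v p - v q) ^ 2 := by
    intro ρ hρ
    have hρ' := mem_range.1 hρ
    rw [list_sum_map_eq_countPair 58 (fun p q => (v p - v q) ^ 2) (ordPairs ρ) (ordPairs_lt hρ')]
    refine Finset.sum_congr rfl fun p hp => Finset.sum_congr rfl fun q hq => ?_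
    rw [pqm_eq_countPair hρ' (mem_range.1 hp) (mem_range.1 hq)]
  have hR : (∑ ρ ∈ range 56, (n9 ρ : ℝ) * ((ordPairs ρ).map fun pq => (v pq.1 - v pq.2) ^ 2).sum)
      = ∑ ρ ∈ range 56, (n9 ρ : ℝ) * ∑ p ∈ range 58, ∑ q ∈ range 58, (pqm ρ p q : ℝ) * (v p - v q) ^ 2 :=
    Finset.sum_congr rfl (fun ρ hρ => by rw [hl ρ hρ])
  rw [hR]
  simp_rw [Finset.mul_sum, Finset.sum_mul]
  conv_rhs => rw [Finset.sum_comm]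
  refine Finset.sum_congr rfl fun r _ => ?_
  conv_rhs => rw [Finset.sum_comm]
  refine Finset.sum_congr rfl fun s _ => Finset.sum_congr rfl fun ρ _ => by ring

/-- a diagonal matrix as a quadratic form. [folklore] -/
theorem quad_diag (v d : ℕ → ℝ) :
    ∑ r ∈ range 58, ∑ s ∈ range 58, v r * v s * (if r = s then d r else 0) = ∑ r ∈ range 58, d r * v r ^ 2 := by
  refine Finset.sum_congr rfl fun r hr => ?_
  simp_rw [mul_ite, mul_zero]
  rw [Finset.sum_ite_eq (range 58) r, if_pos hr]; ring

/-- **the assembled matrix, expanded:**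
`Σ v v pEntry D = 30 L(v) + 900 A(v) + Σ_r n8 r v_r² (−1080(1+D) + (1−D)(7200 − 450 A_r) + 480(1−D))`. [folklore] -/
theorem quadEntry_eq (D : ℕ) (v : ℕ → ℝ) :
    quadEntry D v = 30 * lowerC v + 900 * hopC v
      + ∑ r ∈ range 58, (n8 r : ℝ) * (-1080 * (1 + (D : ℝ)) + (1 - (D : ℝ)) * (7200 - 450 * (activeEdges r : ℝ)) + 480 * (1 - (D : ℝ))) * v r ^ 2 := by
  unfold quadEntry pEntry
  push_cast
  have e : ∀ r ∈ range 58, ∀ s ∈ range 58,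
      v r * v s * (30 * (lEntry r s : ℝ) + 225 * (hEntry r s : ℝ)
        + (if r = s then (n8 r : ℝ) * (-1080 * (1 + (D : ℝ)) + (1 - (D : ℝ)) * (7200 - 450 * (activeEdges r : ℝ)) + 480 * (1 - (D : ℝ))) else 0))
      = 30 * (v r * v s * (lEntry r s : ℝ)) + 225 * (v r * v s * (hEntry r s : ℝ))
        + v r * v s * (if r = s then (n8 r : ℝ) * (-1080 * (1 + (D : ℝ)) + (1 - (D : ℝ)) * (7200 - 450 * (activeEdges r : ℝ)) + 480 * (1 - (D : ℝ))) else 0) := by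
    intro r _ s _; ring
  rw [Finset.sum_congr rfl (fun r hr => Finset.sum_congr rfl (fun s hs => e r hr s hs))]
  simp only [Finset.sum_add_distrib, ← Finset.mul_sum]
  rw [quad_lEntry, quad_hEntry_eq_hOff, quad_hOff, quad_diag]
  ring

/-- `pAgree`, unpacked. [folklore] -/
theorem pEntry_eq_pLit {D r s : ℕ} (hD : D = 0 ∨ D = 1) (hr : r < 58) (hs : s < 58) : pEntry D r s = pLit D r s := by
  have key : ∀ h < 2, pAgree D h = true → ∀ i < 29, ∀ s < 58, pEntry D (29 * h + i) s = pLit D (29 * h + i) s := by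
    intro h _ hp i hi s hs
    have := allN_sound (allN_sound hp i hi) s hs
    rwa [beq_iff_eq] at this
  have hlo : pAgree D 0 = true := hD.elim (fun h => by subst h; exact pAgree_zero_lo) (fun h => by subst h; exact pAgree_one_lo)
  have hhi : pAgree D 1 = true := hD.elim (fun h => by subst h; exact pAgree_zero_hi) (fun h => by subst h; exact pAgree_one_hi)
  by_cases hlt : r < 29
  · have := key 0 (by norm_num) hlo r hlt s hs; simpa using this
  · have := key 1 (by norm_num) hhi (r - 29) (by omega) s hs
    rwa [show 29 * 1 + (r - 29) = r by omega] at this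

/-- the assembled form is the certified literal form (`D ∈ {0,1}`). [folklore] -/
theorem quadEntry_eq_quadLit {D : ℕ} (hD : D = 0 ∨ D = 1) (v : ℕ → ℝ) : quadEntry D v = quadLit D v := by
  unfold quadEntry quadLit
  refine Finset.sum_congr rfl fun r hr => Finset.sum_congr rfl fun s hs => ?_
  rw [pEntry_eq_pLit hD (mem_range.1 hr) (mem_range.1 hs)]

/-! ## The main inequality in class variables -/

/-- the `Δ = 0` matrix as forms: `Σ v v pEntry 0 = 30 L + 900 A + 900 W − 600 N`. [folklore] -/
theorem quadEntry_zero_eq (v : ℕ → ℝ) : quadEntry 0 v = 30 * lowerC v + 900 * hopC v + 900 * isingC v - 600 * normC v := by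
  rw [quadEntry_eq]
  push_cast
  have hs : ∑ r ∈ range 58, (n8 r : ℝ) * (-1080 * (1 + 0) + (1 - 0) * (7200 - 450 * (activeEdges r : ℝ)) + 480 * (1 - 0)) * v r ^ 2
      = 900 * isingC v - 600 * normC v := by
    unfold isingC normC
    rw [Finset.mul_sum, Finset.mul_sum, ← Finset.sum_sub_distrib]
    exact Finset.sum_congr rfl fun r _ => by ring
  rw [hs]; ring

/-- the `Δ = 1` matrix as forms: `Σ v v pEntry 1 = 30 L + 900 A − 2160 N`. [folklore] -/
theorem quadEntry_one_eq (v : ℕ → ℝ) : quadEntry 1 v = 30 * lowerC v + 900 * hopC v - 2160 * normC v := by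
  rw [quadEntry_eq]
  push_cast
  have hs : ∑ r ∈ range 58, (n8 r : ℝ) * (-1080 * (1 + 1) + (1 - 1) * (7200 - 450 * (activeEdges r : ℝ)) + 480 * (1 - 1)) * v r ^ 2
      = -2160 * normC v := by
    unfold normC
    rw [Finset.mul_sum]
    exact Finset.sum_congr rfl fun r _ => by ring
  rw [hs]; ring

/-- **main inequality:** for `0 ≤ Δ ≤ 1` and every `v`,
`0 ≤ L(v) − 36(1+Δ) N(v) + 30 (A(v) + (1−Δ) W(v) + (8/15)(1−Δ) N(v))`. [folklore] -/
theorem main_form_nonneg {Δ : ℝ} (h0 : 0 ≤ Δ) (h1 : Δ ≤ 1) (v : ℕ → ℝ) :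
    0 ≤ lowerC v - 36 * (1 + Δ) * normC v + 30 * (hopC v + (1 - Δ) * isingC v + (8/15 : ℝ) * (1 - Δ) * normC v) := by
  have hq0 := quadLit_zero_nonneg v
  have hq1 := quadLit_one_nonneg v
  rw [← quadEntry_eq_quadLit (Or.inl rfl), quadEntry_zero_eq] at hq0
  rw [← quadEntry_eq_quadLit (Or.inr rfl), quadEntry_one_eq] at hq1
  have hnn : 0 ≤ (1 - Δ) * (30 * lowerC v + 900 * hopC v + 900 * isingC v - 600 * normC v)
      + Δ * (30 * lowerC v + 900 * hopC v - 2160 * normC v) :=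
    add_nonneg (mul_nonneg (by linarith) hq0) (mul_nonneg h0 hq1)
  nlinarith [hnn]




/-- **the condensate of the sector-`0` Perron amplitude of `H₄(Δ)` lies above the chord:** `36(1+Δ) ≤ ‖S⁻_tot a‖²`
for `0 ≤ Δ ≤ 1`. [folklore] -/
theorem lowerNormSq_ge_chord {Δ : ℝ} (h0 : 0 ≤ Δ) (h1 : Δ ≤ 1) {a : Cfg → ℝ} (ha : IsPerronSectorGroundAmplitude 4 Δ 0 a) :
    36 * (1 + Δ) ≤ lowerNormSq a := by
  set v : ℕ → ℝ := fun r => a (decode (rep8 r)) with hv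
  have hN : normC v = 1 := by
    unfold normC; rw [← ha.unit, sum_sq_eq_classes ha]
  have hW : ∑ σ, isingW (torusGraph 2 4) σ * a σ ^ 2 = isingC v := by
    unfold isingC; rw [sum_isingW_sq_eq_classes ha]
  have hL : lowerNormSq a = lowerC v := by
    unfold lowerC; rw [lowerNormSq_eq_classes ha]
  have hA : ∑ σ, a σ * fmOp (torusGraph 2 4) a σ = hopC v := by
    unfold hopC; rw [inner_fmOp_eq_classes ha]
  have hE := perron_energy_four ha
  have hsplit : ∑ σ, a σ * (fmOp (torusGraph 2 4) a σ + (1 - Δ) * (isingW (torusGraph 2 4) σ * a σ))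
      = (∑ σ, a σ * fmOp (torusGraph 2 4) a σ) + (1 - Δ) * ∑ σ, isingW (torusGraph 2 4) σ * a σ ^ 2 := by
    rw [Finset.mul_sum, ← Finset.sum_add_distrib]
    exact Finset.sum_congr rfl fun σ _ => by ring
  rw [hsplit, hA, hW] at hE
  have hU := sectorE_le_uniform Δ
  have hmain := main_form_nonneg h0 h1 v
  rw [hN] at hmain
  rw [hL]
  nlinarith [hmain, hE, hU]

/-- **THEOREM (the crux `FerroSideChord` at `M = 4`, all `Δ ∈ [0,1]`, kernel-certified):** for every normalised
`Sᶻ_tot = 0` sector ground state `ψ` of the easy-plane ferromagnet `H₄(Δ) = xxzHamiltonian 1 (torusGraph 2 4) (−1) Δ` on the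
`4 × 4` torus, `(1+Δ)/2 · ((4²/2)(4²/2 + 1)) ≤ Re⟨ψ, S⁺_tot S⁻_tot ψ⟩` — the body of
`Summit.HubbardSuperconductivity.HubbardSuperconductivity.Theses.AnisotropyChord.FerroSideChord` with `M := 4`
(stmt-HubbardSuperconductivity-19089; instance only, the crux asks for every even `M ≥ 4`).
[conjecture: crux FerroSideChord of route AnisotropyChord — instance `M = 4` proved here] -/
theorem ferroSideChord_four :
    ∀ Δ ∈ Set.Icc (0:ℝ) 1, ∀ (ψ : TensorIndex (TorusSite 2 4) 2 → ℂ),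
      ψ ∈ spinZSector (Λ := TorusSite 2 4) 1 0 → star ψ ⬝ᵥ ψ = 1 →
      Matrix.mulVec (xxzHamiltonian 1 (torusGraph 2 4) (-1) Δ) ψ
        = ((lowestEnergyInSector 1 (xxzHamiltonian 1 (torusGraph 2 4) (-1) Δ) 0 : ℝ) : ℂ) • ψ →
      (1 + Δ) / 2 * (((4 : ℕ) : ℝ) ^ 2 / 2 * (((4 : ℕ) : ℝ) ^ 2 / 2 + 1))
        ≤ (star ψ ⬝ᵥ Matrix.mulVec ((∑ x : TorusSite 2 4, onSite x (spinRaise 1))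
            * (∑ y : TorusSite 2 4, onSite y (spinLower 1))) ψ).re := by
  intro Δ hΔ ψ hψK hψ1 hHψ
  obtain ⟨a, ha⟩ := exists_perron_zero_of_even (L := 4) Δ (by decide)
  rw [lambda_eq_lowerNormSq_of_sectorGround Δ 0 a ha ψ hψK hψ1 hHψ]
  have h := lowerNormSq_ge_chord hΔ.1 hΔ.2 ha
  push_cast
  nlinarith [h]


end Summit.HubbardSuperconductivity.HubbardSuperconductivity.Theorems.AnisotropyChord.FourTorus
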